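import Summits.Ventures.Crystal3D.Theorems.StickyWulffConstantCoaxialWallLawPayerEndPairsMultiPlatesExit
import Summits.Ventures.Crystal3D.Theorems.StickyWulffConstantCoaxialWallLawBarlowCoreRigidity
import Summits.Ventures.Crystal3D.Theorems.StickyWulffConstantCoaxialWallLawBarlowPlateSources
import Summits.Ventures.Crystal3D.Theorems.StickyWulffConstantCoaxialWallLawBarlowNoEntry
import Summits.Ventures.Crystal3D.Theorems.StickyWulffConstantCoaxialWallLawBarlowOneFccCellHyps
import HarnessLib

/-!
# The ONE-FCC F_layer cell, SECOND FAMILY: END PAIRS of the fcc BOTTOM plate's own-dozen word net run INTO the faulted top plate (file (B″))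

HONEST FRAMING. Venture `Summits/Ventures/Crystal3D` (cell `crystal3d-full`); helper `--supports` the crux `CoaxialWallLaw`
(stmt-Ventures-19481, REGISTERED line `WallLedgerF`) in its role as owner of lane T's debt T-F2 / F_layer, OneFcc half
(`FLayerTwinFamilyOneFccAt (13/25) C 10`, …TexShadowFLayerSplitDefs); cf-p1 DECISIONS (civ)/(cxx) «OneFcc = TWO FAMILIES».  Inputs
`KissingGap δ`, `KissingClassification δ` by name; census-free; nothing about the crux is claimed; F-C1 not moved.  Memos
HOME/wall-19481-p1/g15/ONEFCC-ASSEMBLY-PLAN-g15.md §CORRECTION, HOME/wall-19481-p1/g16/TWO-FAMILY-LEDGER-g16.md.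

WHY A SECOND FAMILY (the CORRECTION of 2026-08-29T05:45Z).  The census row pays `Σ(12 − deg) ≥ #ends / sF`; the faulted plate's
OPPOSITE tree alone (`wordNet_barlow_endPairs_oneFcc`, p698172) certifies only `2·(#h + #c_opp)` chord-units of ends per charged stretch,
`54 %` of the law at `sF = 9/2`.  The fcc plate's OWN tree, run into the faulted plate, supplies the missing ends: its walkers enter the
faulted plate ONLY at `h`- and `c_D`-layer balls (no word state exists at a `c_opp`-layer ball, which is FULL in the twin dozen:
`hPexcl0_of_fullTwinPlate`, p697004), and by CORE RIGIDITY (`word_eq_nil_of_face_plateBall`, p696331) they do so IN THE ROOT CLASS along the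
in-plane root — so the exits are ONE PER ROOT LINE on the `h ∪ c_D` layers, a lattice-line count the flux file bounds.

THE CELL.  Bottom plate = a clamped SIGN-CONSTANT Barlow plate `stacking L₁ s₁ σ₁` (`σ₁ ≡ ε`), FULL in `Gf ∈ {L₁, basalMirror ≫ L₁}`;
top plate = a clamped Barlow plate `stacking L₂ s₂ σ₂` (ANY Hägg word).  The word net is built over a ROOT FRAME `FrB` which (i) carries the
bottom plate's dozen (`hdozen : FrB '' D = Gf '' D`, so the bottom core is FULL in `FrB` — every core ball is a source along every rising
in-plane root of `FrB`), and (ii) is a STANDARD-PAIR frame of the top plate's presentation, `FrB = S.G₀ ≫ L₂` with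
`{S.G₀ '' D, (basalMirror ≫ S.G₀) '' D} = {D₊, D₋}` (the input shape of the core rigidity; in the assembly `S.G₀` is the half-turn `H` or
`−id`, so that the twin row of record `EndRowTwinHalfTurnA` covers this family as its system `S₂` after the cell mirror, resp. as `S₁`).
`Gt ∈ {L₂, basalMirror ≫ L₂}` is the top frame of sign `t` whose dozen is the basal TWIN of `FrB`'s (`htwin`): the top balls on layers `k`
with `(σ₂ (k−1), σ₂ k) = (t, t)` are FULL in `Gt` and admit no state.  The plate-abstract census with exits
`word_endPairs_multi_plates_exit` (…PayerEndPairsMultiPlatesExit) is run at the SHIFTED constants `(R₀+1, ρ−1)` with the trivial invariant: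
* sources `hPsrc`: FULL readings at the bottom core (`face_of_isFull`, `isFull_plateBall` / `isFull_mirror_plateBall` transported along `hdozen`);
* core rigidity `hstd`: **`word_eq_nil_of_face_full`** (this file) — a class reading an occupied face at a ball FULL in the root dozen IS the
  root class (`shell_slot_of_full` + `image_fccSlots_eq_of_triangle` + word rigidity `word_eq_of_image_eq`);
* top rigidity `hPexit`: `word_eq_nil_of_face_plateBall` at the top band (radius-`2` balls inside the top clamp, `topBand₂_deep`), and the
  layer type `¬ (σ₂ (k−1) = t ∧ σ₂ k = t)` of the target by `hPexcl0_of_fullTwinPlate`;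
* sealing `hsealB` / `hP₂seal` = `sealing_below_barlow` / `sealing_above_barlow` (…BarlowOneFccCellHyps).
**`wordNet_barlow_endPairs_oneFccB`** — the pooled end pairs `T`: the RAW source count (ALL core-band balls crossing into the window, summed
over the rising in-plane roots of `FrB`) is at most `#T + Σ_r #EXIT_r + #RT·rims`, `EXIT_r` = the top-band balls within lateral `ρ − 3` on
layers of type `≠ (t, t)` whose `r`-predecessor lies below the band; every pair is in `X × X` at distance `1` in the window, has the two-payer
property, and is witnessed by an admissible class of the plate system `⟨FrB, inPlaneRoots FrB 1⟩` with the predecessor clause and `IsEndMove`.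
WHAT THIS IS NOT: the flux bounds (sources from below, exits from above), the mirrored pull-back, the two-family row and the currency glue are
the next files; F-C1 not moved.
-/

noncomputable section

namespace Summit.Ventures.Crystal3D.Theorems

open Summit.Ventures.Crystal3D Finset
open Literature.MathematicalPhysics.StatisticalMechanics (barlowPos barlowStacking IsHaggSeq barlowPos_mem basalMirror
  basalMirror_apply_coord basalMirror_basalMirror)
open Summit.Ventures.Crystal3D.Cruxes.TextureLiminf.TexShadow (E3 stacking)
open scoped InnerProductSpace

/-! ### Rigidity at a ball FULL in the root dozen -/

section FullRigidity

variable {X : Finset E3} (hX : ∀ p ∈ X, ∀ q ∈ X, p ≠ q → 1 ≤ dist p q)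
  {F : List E3 → (E3 ≃ₗᵢ[ℝ] E3)} {u : List E3 → E3} {WF : List E3 → Prop}
  (hFc : ∀ μ κ, F (μ :: κ) = ((ℝ ∙ μ)ᗮ.reflection).trans (F κ))
  (huc : ∀ μ κ, u (μ :: κ) = -u κ)
  (hWFc : ∀ μ κ, WF (μ :: κ) ↔ (WF κ ∧ ‖μ‖ = 1 ∧
    (∀ w ∈ fccSlots, ⟪w, μ⟫_ℝ = 0 ∨ ⟪w, μ⟫_ℝ = Real.sqrt (2 / 3) ∨ ⟪w, μ⟫_ℝ = -Real.sqrt (2 / 3)) ∧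
    ⟪u κ, μ⟫_ℝ = Real.sqrt (2 / 3) ∧ ∀ μ' κ', κ = μ' :: κ' → μ' ≠ -μ))
  (hWF0 : WF [])

include hX hFc huc hWFc hWF0

/-- **A well-formed class reading an occupied `60°` face at a ball FULL in the ROOT dozen is the root class.**  (An occupied point at
distance `1` from a full ball is a slot of its shell; a slot triangle determines the dozen; the dozen determines the word.) -/
theorem word_eq_nil_of_face_full {b : E3} (hfull : IsFull X (F []) b) {κ : List E3} (hκ : WF κ)
    (hface : ∃ a ∈ fccSlots, ∃ a' ∈ fccSlots, ∃ a'' ∈ fccSlots,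
      ⟪a, a'⟫_ℝ = 1 / 2 ∧ ⟪a, a''⟫_ℝ = 1 / 2 ∧ ⟪a', a''⟫_ℝ = 1 / 2 ∧
      b + F κ a ∈ X ∧ b + F κ a' ∈ X ∧ b + F κ a'' ∈ X) : κ = [] := by
  obtain ⟨a, ha, a', ha', a'', ha'', i1, i2, i3, h1, h2, h3⟩ := hface
  have slot : ∀ {c : E3}, c ∈ fccSlots → b + F κ c ∈ X → F κ c ∈ (F [] : E3 → E3) '' ↑fccSlots := by
    intro c hc hbc
    obtain ⟨w, hw, hwc⟩ := shell_slot_of_full hX (F []) hfull hbc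
      (by rw [LinearIsometryEquiv.norm_map, norm_eq_one_of_mem_fccSlots hc])
    exact ⟨w, Finset.mem_coe.2 hw, hwc⟩
  have himg := image_fccSlots_eq_of_triangle (F κ) (F []) ha ha' ha'' i1 i2 i3 (slot ha h1) (slot ha' h2) (slot ha'' h3)
  exact word_eq_of_image_eq hFc huc hWFc hκ hWF0 himg

end FullRigidity

/-! ### The cell export -/

open scoped Classical in
/-- **The ONE-FCC cell's second family: pooled end pairs of the fcc bottom plate's own-dozen word net into the faulted top plate, typed
export with exits.**  See the module docstring. -/
theorem wordNet_barlow_endPairs_oneFccB (ver : WordVersion) {δ : ℝ} (hg : KissingGap δ) (hc : KissingClassification δ)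
    {σ₁ σ₂ : ℤ → ℤ} (hσ₂ : IsHaggSeq σ₂) (L₁ L₂ : E3 ≃ₗᵢ[ℝ] E3) (s₁ s₂ : E3)
    -- the bottom plate is sign-constant, FULL in `Gf`
    (Gf : E3 ≃ₗᵢ[ℝ] E3) {ε : ℤ} (hGf : (ε = 1 ∧ Gf = L₁) ∨ (ε = -1 ∧ Gf = basalMirror.trans L₁))
    (hσ₁ : ∀ n : ℤ, σ₁ n = ε)
    -- the root frame: the bottom dozen, presented as a standard-pair frame of the top plate
    (S : PlateSystem)
    (hG₀ : ((S.G₀ : E3 → E3) '' ↑fccSlots = ↑fccSlots ∧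
        ((basalMirror.trans S.G₀ : E3 ≃ₗᵢ[ℝ] E3) : E3 → E3) '' ↑fccSlots = (basalMirror : E3 → E3) '' ↑fccSlots) ∨
      ((S.G₀ : E3 → E3) '' ↑fccSlots = (basalMirror : E3 → E3) '' ↑fccSlots ∧
        ((basalMirror.trans S.G₀ : E3 ≃ₗᵢ[ℝ] E3) : E3 → E3) '' ↑fccSlots = ↑fccSlots))
    (FrB : E3 ≃ₗᵢ[ℝ] E3) (hFrB : FrB = S.G₀.trans L₂)
    (hdozen : (FrB : E3 → E3) '' ↑fccSlots = (Gf : E3 → E3) '' ↑fccSlots)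
    -- the top frame whose dozen is the basal twin of the root dozen, and its sign
    (Gt : E3 ≃ₗᵢ[ℝ] E3) {t : ℤ} (hGt : (t = 1 ∧ Gt = L₂) ∨ (t = -1 ∧ Gt = basalMirror.trans L₂))
    (htwin : (Gt : E3 → E3) '' ↑fccSlots = (fun x => FrB (basalMirror x)) '' ↑fccSlots)
    (X P₁ P₂ : Finset E3) (R₀ h ρ : ℝ) (hR₀ : 5 ≤ R₀) (hρ : R₀ + 2 ≤ ρ)
    (hX : ∀ p ∈ X, ∀ q ∈ X, p ≠ q → 1 ≤ dist p q) (hP₁X : P₁ ⊆ X) (hP₂X : P₂ ⊆ X)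
    (hP₁ : ∀ p, p ∈ P₁ ↔ (p ∈ stacking L₁ s₁ σ₁ ∧ -(2 * R₀) ≤ p 2 ∧ p 2 ≤ -R₀ ∧ p 0 ^ 2 + p 1 ^ 2 ≤ ρ ^ 2))
    (hP₂ : ∀ p, p ∈ P₂ ↔ (p ∈ stacking L₂ s₂ σ₂ ∧ h + R₀ ≤ p 2 ∧ p 2 ≤ h + 2 * R₀ ∧ p 0 ^ 2 + p 1 ^ 2 ≤ ρ ^ 2)) :
    ∃ T : Finset (E3 × E3),
      (∑ r ∈ inPlaneRoots FrB 1,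
        ((P₁.filter fun p => -(R₀ + 1) - 1 - 1 ≤ p 2 ∧ p 2 ≤ -(R₀ + 1) - 1 ∧ p 0 ^ 2 + p 1 ^ 2 ≤ (ρ - 1 - 1) ^ 2).filter
          fun p => -(R₀ + 1) - 1 < (p + FrB r) 2 ∧ (p + FrB r) 2 < h + (R₀ + 1) + 1).card ≤
        T.card +
          (∑ r ∈ inPlaneRoots FrB 1,
            (X.filter fun b => h + (R₀ + 1) + 1 ≤ b 2 ∧ b 2 ≤ h + (R₀ + 1) + 1 + 1 ∧ b 0 ^ 2 + b 1 ^ 2 ≤ (ρ - 1 - 2) ^ 2 ∧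
              (b - FrB r) 2 < h + (R₀ + 1) + 1 ∧
              ∃ k i j : ℤ, b = L₂ (barlowPos 1 (Real.sqrt (2 / 3)) σ₂ k i j) + s₂ ∧ ¬ (σ₂ (k - 1) = t ∧ σ₂ k = t)).card) +
          (inPlaneRoots FrB 1).card *
          (220 * (X.filter fun s => h + (R₀ + 1) + 1 ≤ s 2 ∧ s 2 ≤ h + (R₀ + 1) + 1 + 1 ∧
              (ρ - 1 - 2) ^ 2 < s 0 ^ 2 + s 1 ^ 2).card +
            220 * (X.filter fun s => -(R₀ + 1) - 1 - 1 ≤ s 2 ∧ s 2 < -(R₀ + 1) - 1 ∧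
              (ρ - 1 - 1) ^ 2 < s 0 ^ 2 + s 1 ^ 2).card)) ∧
      (∀ bq ∈ T, bq.1 ∈ X ∧ bq.2 ∈ X ∧ dist bq.1 bq.2 = 1 ∧ -(R₀ + 1) - 1 ≤ bq.1 2 ∧ bq.1 2 < h + (R₀ + 1) + 1) ∧
      (∀ bq ∈ T, (X.filter fun q => dist bq.1 q = 1).card ≤ 11 ∨
        ∃ z₁ ∈ X, ∃ z₂ ∈ X, z₁ ≠ z₂ ∧ dist bq.1 z₁ = 1 ∧ dist bq.1 z₂ = 1 ∧
          (X.filter fun q => dist z₁ q = 1).card ≤ 11 ∧ (X.filter fun q => dist z₂ q = 1).card ≤ 11) ∧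
      (∀ bq ∈ T, ∃ r ∈ inPlaneRoots FrB 1, ∃ κ : List E3, WFChain r κ ∧
        bq.2 - (⟨FrB, inPlaneRoots FrB 1⟩ : PlateSystem).Fw κ (((-1 : ℝ) ^ κ.length) • r) ∈ X ∧
        IsEndMove X ver ((⟨FrB, inPlaneRoots FrB 1⟩ : PlateSystem).Fw κ)
          ((⟨FrB, inPlaneRoots FrB 1⟩ : PlateSystem).Fw κ (((-1 : ℝ) ^ κ.length) • r)) bq.2 bq.1) := by
  set RT := inPlaneRoots FrB 1 with hRTdef
  have hRT : ∀ r ∈ RT, r ∈ fccSlots := fun r hr => (mem_filter.1 hr).1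
  have hRT2 : ∀ r ∈ RT, r 2 = 0 := fun r hr => (mem_filter.1 hr).2.1
  have hRTup : ∀ r ∈ RT, 0 < (FrB r) 2 := fun r hr => by
    have := (mem_filter.1 hr).2.2; rwa [one_mul] at this
  -- the word data over the base frame `FrB`
  set Fw : List E3 → (E3 ≃ₗᵢ[ℝ] E3) := fun κ => κ.foldr (fun μ G => ((ℝ ∙ μ)ᗮ.reflection).trans G) FrB with hFw
  set uw : E3 → List E3 → E3 := fun r κ => κ.foldr (fun _ v => -v) r with huw
  set WFw : E3 → List E3 → Prop := fun r κ =>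
    List.rec (motive := fun _ => Prop) True (fun μ κ' ih => ih ∧ ‖μ‖ = 1 ∧
      (∀ w ∈ fccSlots, ⟪w, μ⟫_ℝ = 0 ∨ ⟪w, μ⟫_ℝ = Real.sqrt (2 / 3) ∨ ⟪w, μ⟫_ℝ = -Real.sqrt (2 / 3)) ∧
      ⟪uw r κ', μ⟫_ℝ = Real.sqrt (2 / 3) ∧ ∀ μ' κ'', κ' = μ' :: κ'' → μ' ≠ -μ) κ with hWFw
  set nextw : List E3 → E3 → List E3 :=
    fun κ m => @ite _ (∃ μ κ', κ = μ :: κ' ∧ (Fw κ).symm m = -μ) (Classical.propDecidable _) κ.tail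
      ((Fw κ).symm m :: κ) with hnextw
  have hF0 : Fw [] = FrB := rfl
  have hFc : ∀ μ κ, Fw (μ :: κ) = ((ℝ ∙ μ)ᗮ.reflection).trans (Fw κ) := fun _ _ => rfl
  have hu0 : ∀ r, uw r [] = r := fun _ => rfl
  have huc : ∀ r μ κ, uw r (μ :: κ) = -uw r κ := fun _ _ _ => rfl
  have hWF0 : ∀ r, WFw r [] := fun _ => trivial
  have hWFc : ∀ r μ κ, WFw r (μ :: κ) ↔ (WFw r κ ∧ ‖μ‖ = 1 ∧
      (∀ w ∈ fccSlots, ⟪w, μ⟫_ℝ = 0 ∨ ⟪w, μ⟫_ℝ = Real.sqrt (2 / 3) ∨ ⟪w, μ⟫_ℝ = -Real.sqrt (2 / 3)) ∧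
      ⟪uw r κ, μ⟫_ℝ = Real.sqrt (2 / 3) ∧ ∀ μ' κ', κ = μ' :: κ' → μ' ≠ -μ) := fun _ _ _ => Iff.rfl
  have hnext_pop : ∀ μ κ' (m : E3), (Fw (μ :: κ')).symm m = -μ → nextw (μ :: κ') m = κ' := by
    intro μ κ' m hν
    simp only [hnextw]
    rw [if_pos ⟨μ, κ', rfl, hν⟩, List.tail_cons]
  have hnext_push : ∀ κ (m : E3), (∀ μ κ', κ = μ :: κ' → (Fw κ).symm m ≠ -μ) → nextw κ m = (Fw κ).symm m :: κ := by
    intro κ m hnp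
    simp only [hnextw]
    rw [if_neg]
    rintro ⟨μ, κ', h, hν⟩
    exact hnp μ κ' h hν
  clear_value nextw WFw uw Fw
  -- the cell: clamps, core band, top band
  set W₁ : Set E3 := {x : E3 | -(2 * R₀) ≤ x 2 ∧ x 2 ≤ -R₀ ∧ x 0 ^ 2 + x 1 ^ 2 ≤ ρ ^ 2} with hW₁
  set W₂ : Set E3 := {x : E3 | h + R₀ ≤ x 2 ∧ x 2 ≤ h + 2 * R₀ ∧ x 0 ^ 2 + x 1 ^ 2 ≤ ρ ^ 2} with hW₂
  have hplate₁ : ∀ p ∈ stacking L₁ s₁ σ₁, p ∈ W₁ → p ∈ X := plate_mem_of_clamp₁ L₁ s₁ hP₁X hP₁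
  have hplate₂ : ∀ p ∈ stacking L₂ s₂ σ₂, p ∈ W₂ → p ∈ X := plate_mem_of_clamp₂ L₂ s₂ hP₂X hP₂
  set CORE := P₁.filter (fun p => -(R₀ + 1) - 1 - 1 ≤ p 2 ∧ p 2 ≤ -(R₀ + 1) - 1 ∧
    p 0 ^ 2 + p 1 ^ 2 ≤ (ρ - 1 - 1) ^ 2) with hCORE
  set TOP := P₂.filter (fun p => h + (R₀ + 1) + 1 ≤ p 2 ∧ p 2 ≤ h + (R₀ + 1) + 1 + 1 ∧
    p 0 ^ 2 + p 1 ^ 2 ≤ (ρ - 1 - 2) ^ 2) with hTOP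
  have hcore : ∀ p ∈ CORE, ∃ k i j : ℤ, p = L₁ (barlowPos 1 (Real.sqrt (2 / 3)) σ₁ k i j) + s₁ ∧
      ∀ x, dist p x ≤ 2 → x ∈ W₁ := coreBand₁_deep L₁ s₁ hP₁ hR₀ (by linarith)
  have htop : ∀ p ∈ TOP, ∃ k i j : ℤ, p = L₂ (barlowPos 1 (Real.sqrt (2 / 3)) σ₂ k i j) + s₂ ∧
      ∀ x, dist p x ≤ 2 → x ∈ W₂ := topBand₂_deep L₂ s₂ hP₂ hR₀ (by linarith)
  have hCOREX : ∀ p ∈ CORE, p ∈ X := fun p hp => hP₁X (mem_filter.1 hp).1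
  -- the bottom core is FULL in `Gf`, hence in the root frame
  have hGfull : ∀ p ∈ CORE, IsFull X Gf p := by
    intro p hp
    obtain ⟨k, i, j, rfl, hW⟩ := hcore p hp
    rcases hGf with ⟨hε, hG⟩ | ⟨hε, hG⟩
    · rw [hG]; exact isFull_plateBall L₁ s₁ hX hplate₁ k i j hW (by rw [hσ₁, hε]) (by rw [hσ₁, hε])
    · rw [hG]; exact isFull_mirror_plateBall L₁ s₁ hX hplate₁ k i j hW (by rw [hσ₁, hε]) (by rw [hσ₁, hε])
  have hFrfull : ∀ p ∈ CORE, IsFull X (Fw []) p := by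
    intro p hp w hw
    have hmem : Fw [] w ∈ (Gf : E3 → E3) '' ↑fccSlots := by
      rw [hF0, ← hdozen]; exact ⟨w, Finset.mem_coe.2 hw, rfl⟩
    obtain ⟨w', hw', hww'⟩ := hmem
    rw [← hww']
    exact hGfull p hp w' (Finset.mem_coe.1 hw')
  -- the trivial admissibility predicate and invariant
  set srcOK : E3 → E3 → Prop := fun _ _ => True with hsrcOK
  -- (1) sources: FULL readings
  have hPsrc : ∀ r ∈ RT, ∀ p ∈ CORE, srcOK r p → p ∈ X ∧
      (∃ a ∈ fccSlots, ∃ a' ∈ fccSlots, ∃ a'' ∈ fccSlots,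
        ⟪a, a'⟫_ℝ = 1 / 2 ∧ ⟪a, a''⟫_ℝ = 1 / 2 ∧ ⟪a', a''⟫_ℝ = 1 / 2 ∧
        p + Fw [] a ∈ X ∧ p + Fw [] a' ∈ X ∧ p + Fw [] a'' ∈ X) ∧
      p - Fw [] r ∈ X ∧
      (IsFull X (Fw []) p ∨ (∃ m, IsTwinReading X (Fw []) m p ∧ ⟪Fw [] r, m⟫_ℝ = 0) ∨
        (ver = WordVersion.v2 ∧ IsNarrow X (Fw []) (Fw [] r) p)) ∧
      (fun (_ : E3) (_ : E3 × List E3) => True) r (p + Fw [] r, []) := by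
    intro r hr p hp _
    have hfull := hFrfull p hp
    refine ⟨hCOREX p hp, face_of_isFull (Fw []) hfull, ?_, Or.inl hfull, trivial⟩
    have := hfull (-r) (neg_mem_fccSlots (hRT r hr))
    rw [map_neg, ← sub_eq_add_neg] at this
    exact this
  -- (2) core rigidity: a class reading a face at a FULL core ball is the root class
  have hstd : ∀ r ∈ RT, ∀ κ, WFw r κ → ∀ p ∈ CORE, (∃ a ∈ fccSlots, ∃ a' ∈ fccSlots, ∃ a'' ∈ fccSlots,
        ⟪a, a'⟫_ℝ = 1 / 2 ∧ ⟪a, a''⟫_ℝ = 1 / 2 ∧ ⟪a', a''⟫_ℝ = 1 / 2 ∧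
        p + Fw κ a ∈ X ∧ p + Fw κ a' ∈ X ∧ p + Fw κ a'' ∈ X) → Fw κ (uw r κ) = Fw [] r := by
    intro r hr κ hκ p hp hface
    have hnil : κ = [] := word_eq_nil_of_face_full hX hFc (huc r) (hWFc r) (hWF0 r) (hFrfull p hp) hκ hface
    rw [hnil, hu0]
  -- (3) top rigidity: a class reading a face at a top-band ball is the root class, and the ball is not of type `(t, t)`
  have hTfull : ∀ b ∈ TOP, ∀ k i j : ℤ, b = L₂ (barlowPos 1 (Real.sqrt (2 / 3)) σ₂ k i j) + s₂ →
      σ₂ (k - 1) = t → σ₂ k = t → IsFull X Gt b := by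
    intro b hb k i j hbk h1 h2
    obtain ⟨k', i', j', -, hW⟩ := htop b hb
    have hW' : ∀ x, dist (L₂ (barlowPos 1 (Real.sqrt (2 / 3)) σ₂ k i j) + s₂) x ≤ 2 → x ∈ W₂ := by
      rw [← hbk]; exact hW
    rw [hbk]
    rcases hGt with ⟨ht, hG⟩ | ⟨ht, hG⟩
    · rw [hG]; exact isFull_plateBall L₂ s₂ hX hplate₂ k i j hW' (by rw [h1, ht]) (by rw [h2, ht])
    · rw [hG]; exact isFull_mirror_plateBall L₂ s₂ hX hplate₂ k i j hW' (by rw [h1, ht]) (by rw [h2, ht])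
  have htwin' : (Gt : E3 → E3) '' ↑fccSlots = (fun x => Fw [] (basalMirror x)) '' ↑fccSlots := by rw [hF0]; exact htwin
  have hPexit : ∀ r ∈ RT, ∀ (b : E3) (κ : List E3), WFw r κ →
      (fun (_ : E3) (_ : E3 × List E3) => True) r (b, κ) → b ∈ TOP →
      (∃ a ∈ fccSlots, ∃ a' ∈ fccSlots, ∃ a'' ∈ fccSlots,
        ⟪a, a'⟫_ℝ = 1 / 2 ∧ ⟪a, a''⟫_ℝ = 1 / 2 ∧ ⟪a', a''⟫_ℝ = 1 / 2 ∧
        b + Fw κ a ∈ X ∧ b + Fw κ a' ∈ X ∧ b + Fw κ a'' ∈ X) →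
      κ = [] ∧ ∃ k i j : ℤ, b = L₂ (barlowPos 1 (Real.sqrt (2 / 3)) σ₂ k i j) + s₂ ∧ ¬ (σ₂ (k - 1) = t ∧ σ₂ k = t) := by
    intro r hr b κ hκ _ hb hface
    obtain ⟨k, i, j, hbk, hW⟩ := htop b hb
    refine ⟨?_, k, i, j, hbk, ?_⟩
    · -- core rigidity of the TOP plate in the standard-pair frame `FrB = S.G₀ ≫ L₂`
      have key := word_eq_nil_of_face_plateBall hσ₂ L₂ s₂ hX hplate₂ S hG₀ hFc (by rw [hF0, hFrB]) (hRT2 r hr)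
        (hu0 r) (huc r) (hWFc r) k i j (by rw [← hbk]; exact hW) hκ (by rw [← hbk]; exact hface)
      exact key
    · -- a `(t, t)` ball is FULL in the twin dozen: no face
      rintro ⟨h1, h2⟩
      have hfullT : ∀ b' ∈ ({b} : Finset E3), IsFull X Gt b' := by
        intro b' hb'; rw [Finset.mem_singleton.1 hb']; exact hTfull b hb k i j hbk h1 h2
      exact hPexcl0_of_fullTwinPlate hX hFc (huc r) (hWFc r) (by rw [hu0]; exact hRT2 r hr) Gt htwin' hfullT
        (fun _ => True) b κ hκ trivial (Finset.mem_singleton_self b) hface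
  -- (4) sealing
  have hsealB := sealing_below_barlow L₁ s₁ hX hP₁X hP₁ (R₀ := R₀) (ρ := ρ) (by linarith) (by linarith)
  have hP₂seal := sealing_above_barlow L₂ s₂ hX hP₂X hP₂ (R₀ := R₀) (h := h) (ρ := ρ) (by linarith) (by linarith)
  -- (5) the census with exits
  have hup : ∀ r ∈ RT, 0 < (Fw [] r) 2 := fun r hr => by rw [hF0]; exact hRTup r hr
  have hP'top : ∀ p ∈ CORE, p 2 ≤ -(R₀ + 1) - 1 := fun p hp => (mem_filter.1 hp).2.2.1
  obtain ⟨T, hkey, hTpair, hTpay, hTwit⟩ := word_endPairs_multi_plates_exit ver (F := Fw) (u := uw) (WF := WFw)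
    (next := nextw) (P := fun _ _ => True) hg hc hX hFc RT hRT (fun r _ => hu0 r) (fun r _ => huc r)
    (fun r _ => hWF0 r) (fun r _ => hWFc r) hnext_pop hnext_push (fun _ _ _ _ _ _ _ => trivial)
    (fun _ _ _ _ _ _ _ _ _ _ => trivial)
    (fun b => ∃ k i j : ℤ, b = L₂ (barlowPos 1 (Real.sqrt (2 / 3)) σ₂ k i j) + s₂ ∧ ¬ (σ₂ (k - 1) = t ∧ σ₂ k = t))
    hPexit hup (by linarith : (3 : ℝ) ≤ R₀ + 1) (by linarith : R₀ + 1 ≤ ρ - 1)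
    srcOK hP'top hPsrc hstd hsealB hP₂seal
  rw [hF0] at hkey
  -- (6) the witnesses in the plate-system form
  set SB : PlateSystem := ⟨FrB, RT⟩ with hSB
  have hFwS : ∀ κ, Fw κ = SB.Fw κ := by
    intro κ
    induction κ with
    | nil => rw [hF0]; rfl
    | cons μ κ ih => rw [hFc, ih]; rfl
  refine ⟨T, ?_, hTpair, hTpay, ?_⟩
  · -- the source filter is `True ∧ …`
    simp only [hsrcOK, true_and] at hkey
    convert hkey using 3
  · intro bq hbq
    obtain ⟨r, hr, -, κ, hκ, hpred, hmove⟩ := hTwit bq hbq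
    have hWF : WFChain r κ := wfChain_of_wf (hu0 r) (huc r) (hWFc r) κ hκ
    have hu : uw r κ = ((-1 : ℝ) ^ κ.length) • r := word_u_eq_pow_root (hu0 r) (huc r) κ
    rw [hu, hFwS] at hpred hmove
    exact ⟨r, hr, κ, hWF, hpred, hmove⟩

end Summit.Ventures.Crystal3D.Theorems

end
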